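import Mathlib
import Summits.Ventures.FusionMHD.Models.SAlphaSecondStableS15A3575Core0
import HarnessLib

/-!
# STABLE-POINT core at `((3 / 2), 143/40)`, piece 8 (`[4, 6]`): kernel-decided Taylor-model leaves ⇒ `F_8 > 0` and `amplitudeResidual (3 / 2) (143/40) F_8 F_8″ ≤ 0` on the piece ⇒ `EnergyDominatesOn` for its amplitude phase

LADDER-GRIDFUSION rung F3 («F3.BALLOON-sα-S3o2-SECOND-EDGE-HALVING-A3575»: the second-edge bracket at s = 3/2 HALVED from the stable side ([17/5, 15/4] → [17/5, 143/40]) (DIRECTOR RULING 67 (5) class / I4107 (2))); gridfusion-model-7 g10, 2026-08-28 (g8/g9 core lane).  Two `decide +kernel` calls (`OpModel.trig.pLeavesCheck`, scale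
`2^60`, Taylor degree 10, 16 leaves of half-width 1/16) and the lane's soundness theorem `OpSem.trig.pos_of_pLeavesCheck`
(Literature/Analysis/ValidatedNumerics/TaylorModelZeroCert); lit-4's `energyDominatesOn_of_amplitude` (BallooningSAlphaStableSide) turns the two
sign facts into energy domination by `amplitudePhase (3 / 2) (143/40) F_8 F_8′` on the piece.  MODELLED: `s–α` model; nothing about a device.
No `native_decide`.  Citations: Freidberg 2014 §12.6.2 (12.97) [Freidberg2014]; Makino–Berz 2003 Alg. 2 [MakinoBerz2003]; Hartman 2002 XI.6.2
[Hartman2002].  Everything here is [instance data].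
-/

open Literature.Analysis.ValidatedNumerics Literature.Analysis.ValidatedNumerics.PolyMP
open Literature.Analysis.ValidatedNumerics.NumericsMP Literature.Analysis.ValidatedNumerics.ExpPoly
open Literature.MathematicalPhysics.MHD.Ballooning
open Real Set

namespace Summit.Ventures.FusionMHD.Models

namespace SAlphaSecondStableS15A3575

/-- KERNEL CHECK (residual leaves of piece 8). [instance data] -/
theorem ss153575_res8_ok : OpModel.trig.pLeavesCheck ss153575Prm (2 ^ 60) (ss153575Prog Zc8 (Poly.deriv (Poly.deriv Zc8))) [] ss153575Leaves8 = true := by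
  decide +kernel

/-- KERNEL CHECK (positivity leaves of piece 8). [instance data] -/
theorem ss153575_pos8_ok : OpModel.trig.pLeavesCheck ss153575Prm (2 ^ 60) (ss153575PosProg Zc8) [] ss153575Leaves8 = true := by
  decide +kernel

/-- The leaves tile `[4, 6]`. [instance data] -/
theorem ss153575_tiles8 : tiles (4 : ℚ) (ss153575Leaves8.map fun l => (l.e, l.k)) (6 : ℚ) = true := by
  decide +kernel

/-- **PIECE 8**: the phase of `F_8` dominates the `s–α` energy on `[4, 6]` at `(s, α) = ((3 / 2), 143/40)`. [instance data] -/
theorem ss153575_dominates8 :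
    SAlpha.EnergyDominatesOn (3 / 2) (143 / 40) (SAlpha.amplitudePhase (3 / 2) (143 / 40) (Poly.eval Zc8) (Poly.eval (Poly.deriv Zc8)))
      (Icc (4 : ℝ) (6 : ℝ)) := by
  have h := ss153575_dominates (lf := Zc8) (x := 4) (y := 6) (by norm_num) ss153575_tiles8 ss153575_res8_ok ss153575_pos8_ok
  norm_num at h
  exact h

end SAlphaSecondStableS15A3575

end Summit.Ventures.FusionMHD.Models
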